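import Literature.NumberTheory.Automorphic.HarishChandraGLIsomorphism
import Literature.NumberTheory.Automorphic.HarishChandraGLCentreInvariant
import HarnessLib

/-!
# The antipode and the Harish-Chandra homomorphism of `𝔤𝔩ₙ`: `γ(S z)(x) = γ(z)(-x)`

Topic `NumberTheory/Automorphic`; a companion of `HarishChandraGL`, `HarishChandraCore`,
`HarishChandraGLIsomorphism`, `HarishChandraGLCentreInvariant`. `𝕜` is `ℝ` or `ℂ` (`RCLike 𝕜`),
`𝔤 = 𝔤𝔩ₙ(𝕜)` as a real Lie algebra, `U(𝔤)` its real enveloping algebra with centre `Z(𝔤)`,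
`γ : Z(𝔤) → ℂ[x_{τ,i}]` a Harish-Chandra homomorphism (`HarishChandraHomGL`). The **antipode**
(principal anti-automorphism) `S` of `U(𝔤)` is the anti-automorphism extending `X ↦ -X`; it is the
adjoint map of every `𝔤`-invariant Hermitian form (`⟨u v, w⟩ = ⟨v, S(u) w⟩`, Knapp–Vogan 1995,
Ch. IX §1), so the infinitesimal character of a unitary module satisfies `θ(z) = \overline{θ(S z)}`.
This file computes `γ ∘ S`:

* **Main theorem** `HarishChandraHomGL.aeval_antiR`: for `z ∈ Z(𝔤)`, `S z ∈ Z(𝔤)` and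
  `γ(S z)(x) = γ(z)(-x)` — the infinitesimal-character form of "the contragredient of the module of
  parameter `λ` has parameter `-λ`" (Knapp 2002, Thm. 5.44 with the `W`-invariance of `γ`).

Proof. `S = U(θ₀) ∘ 𝒯` where `𝒯` is the **transpose anti-automorphism** (`X ↦ Xᵀ`) and `θ₀` the
automorphism `X ↦ -Xᵀ` (`antiR_eq_negTransposeU_trR`).
1. `𝒯` **fixes the centre pointwise** (`trR_eq_self_of_mem_center`). On the complexification
   `U(𝔤_ℂ) = U(∏_τ 𝔤𝔩ₙ(ℂ))` (`HarishChandraGLIsomorphism.envHom`, injective, intertwining the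
   transposes, `envHom_trR`) the centre is generated by the Casimir (Gelfand) elements
   `C_{τ,k} = tr(𝔼_τ^k)` of `HarishChandraCore` — this is Harish-Chandra's surjectivity made
   explicit: every block-symmetric polynomial is `γ'(P(C))` for a polynomial `P` in the Casimirs
   (`HCCore.exists_zOfPoly_gamma_eq`, the induction of `HCCore.exists_eq_gamma_of_mem` with the
   witnesses recorded), so by injectivity of `γ'` every central element is such a `P(C)`
   (`HCCore.exists_zOfPoly_eq`); and `𝒯 (C_{τ,k}) = C_{τ,k}` (`HCCore.trU_casimir`: the transposed
   reversed cycle `E_{a₁a_k} ⋯ E_{a₂a₁}` is again a cycle).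
2. `γ(U(θ₀) z)(x) = γ(z)(-x)` (`HarishChandraHomGL.aeval_negTransposeU`): the adjoint group fixes
   the centre (`lift_comp_conj_eq_lift` of `HarishChandraGLCentreInvariant`), so `U(θ₀) z` acts on
   the model module as `z` does on its **Weyl twist** by `Ad(w₀) ∘ θ₀` (`w₀` the order-reversing
   permutation matrix), an automorphism preserving `𝔫` and acting on weights by `λ ↦ -λ ∘ rev`
   (`IsHighestWeightVector.weylTwist`); on the highest weight vector `v_λ` this gives
   `γ(U(θ₀) z)(λ + ρ) = γ(z)(-λ ∘ rev + ρ) = γ(z)((-(λ + ρ)) ∘ rev) = γ(z)(-(λ + ρ))`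
   (`ρ_{rev i} = -ρ_i`, `𝔖ₙ`-symmetry of `γ(z)`).

Also: the opposite-algebra constructions `HCCore.transposeHom`, `transposeHomR`, `antipodeHom`
(algebra maps `U → Uᵐᵒᵖ` from Lie homomorphisms `𝔤 → Uᵐᵒᵖ`), the automorphism `negTransposeU`,
the permutation matrix `revMat` with `Ad(w₀)` on `𝔫` and `𝔥`.

## References

* A. W. Knapp, *Lie Groups Beyond an Introduction*, 2nd ed. (2002), §V.5, Thm. 5.44. [Knapp2002]
* A. W. Knapp, D. A. Vogan, *Cohomological Induction and Unitary Representations* (1995), Ch. IX §1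
  (invariant Hermitian forms), Thm. 4.95. [KnappVogan1995]
* J. Dixmier, *Enveloping Algebras* (1977/1996), 2.2.18 (principal anti-automorphism).
* J. E. Humphreys, *Introduction to Lie Algebras and Representation Theory* (1972), §23.3.
  [Humphreys1972]
-/

-- Mathlib idiom (Mathlib/Algebra/Lie/OfAssociative.lean): the commutator bracket on associative rings
attribute [local instance 100] LieRing.ofAssociativeRing

open scoped Matrix

noncomputable section

namespace Literature.NumberTheory.Automorphic

open MulOpposite MvPolynomial Literature.Algebra.Lie.ChevalleyGL Literature.Algebra.Lie.PBW

/-! ### The transpose anti-automorphism of `U(𝔤𝔩ₙ(ℂ)^T)` fixes the centre pointwise -/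

namespace HCCore

section Transpose

variable (T : Type*) (n : ℕ)

local notation "𝔘" => UniversalEnvelopingAlgebra ℂ (𝔤 T n)

variable {T n} in
/-- Blockwise transpose on `𝔤𝔩ₙ(ℂ)^T`. [folklore] -/
def btranspose (X : 𝔤 T n) : 𝔤 T n := fun τ ↦ (X τ)ᵀ

variable {T n}

/-- Entries of the blockwise transpose. [folklore] -/
@[simp] theorem btranspose_apply (X : 𝔤 T n) (τ : T) (a b : Fin n) :
    btranspose X τ a b = X τ b a := rfl

/-- Transposing twice is the identity. [folklore] -/
theorem btranspose_btranspose (X : 𝔤 T n) : btranspose (btranspose X) = X := rfl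

/-- Transpose is additive. [folklore] -/
theorem btranspose_add (X Y : 𝔤 T n) : btranspose (X + Y) = btranspose X + btranspose Y := rfl

/-- Transpose is homogeneous. [folklore] -/
theorem btranspose_smul (c : ℂ) (X : 𝔤 T n) : btranspose (c • X) = c • btranspose X := rfl

/-- Transpose is a Lie anti-automorphism: `⁅X, Y⁆ᵀ = ⁅Yᵀ, Xᵀ⁆`. [folklore] -/
theorem btranspose_lie (X Y : 𝔤 T n) : btranspose ⁅X, Y⁆ = ⁅btranspose Y, btranspose X⁆ := by
  funext τ
  simp only [btranspose, LieRing.of_associative_ring_bracket, Pi.sub_apply, Pi.mul_apply,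
    Matrix.transpose_sub, Matrix.transpose_mul]

variable (T n)

/-- The blockwise transpose followed by `ι`, as a Lie algebra homomorphism into the OPPOSITE
enveloping algebra (`X ↦ Xᵀ` is a Lie anti-homomorphism). [folklore] -/
def transposeOpLie : 𝔤 T n →ₗ⁅ℂ⁆ (𝔘)ᵐᵒᵖ where
  toFun X := op (UniversalEnvelopingAlgebra.ι ℂ (btranspose X))
  map_add' X Y := by rw [btranspose_add, map_add, op_add]
  map_smul' c X := by rw [btranspose_smul, map_smul, op_smul, RingHom.id_apply]
  map_lie' {X Y} := by
    rw [btranspose_lie, LieHom.map_lie, LieRing.of_associative_ring_bracket,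
      LieRing.of_associative_ring_bracket, op_sub, op_mul, op_mul]

/-- **The transpose anti-automorphism** `𝒯` of `U(𝔤𝔩ₙ(ℂ)^T)`, as an algebra homomorphism
`U → Uᵐᵒᵖ` extending `X ↦ Xᵀ` (Dixmier, *Enveloping Algebras*, 2.2.18: the principal
anti-automorphism composed with the automorphism `X ↦ -Xᵀ`). [folklore] -/
def transposeHom : 𝔘 →ₐ[ℂ] (𝔘)ᵐᵒᵖ :=
  UniversalEnvelopingAlgebra.lift ℂ (transposeOpLie T n)

variable {T n}

/-- `𝒯` as a map `U → U` (notation-free helper). [folklore] -/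
def trU (u : 𝔘) : 𝔘 := unop (transposeHom T n u)

/-- `𝒯 (ι X) = ι (Xᵀ)`. [folklore] -/
theorem trU_ι (X : 𝔤 T n) :
    trU (UniversalEnvelopingAlgebra.ι ℂ X) = UniversalEnvelopingAlgebra.ι ℂ (btranspose X) := by
  rw [trU, transposeHom, UniversalEnvelopingAlgebra.lift_ι_apply]
  rfl

/-- `𝒯` is anti-multiplicative. [folklore] -/
theorem trU_mul (u v : 𝔘) : trU (u * v) = trU v * trU u := by
  rw [trU, map_mul, unop_mul]
  rfl

/-- `𝒯` is additive. [folklore] -/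
theorem trU_add (u v : 𝔘) : trU (u + v) = trU u + trU v := by
  rw [trU, map_add, unop_add]
  rfl

/-- `𝒯 1 = 1`. [folklore] -/
theorem trU_one : trU (1 : 𝔘) = 1 := by
  rw [trU, map_one, unop_one]

/-- `𝒯 0 = 0`. [folklore] -/
theorem trU_zero : trU (0 : 𝔘) = 0 := by
  rw [trU, map_zero, unop_zero]

/-- `𝒯` fixes the scalars. [folklore] -/
theorem trU_algebraMap (c : ℂ) : trU (algebraMap ℂ 𝔘 c) = algebraMap ℂ 𝔘 c := by
  rw [trU, AlgHom.commutes, MulOpposite.algebraMap_apply, unop_op]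

/-- `𝒯` is homogeneous. [folklore] -/
theorem trU_smul (c : ℂ) (u : 𝔘) : trU (c • u) = c • trU u := by
  rw [trU, map_smul, unop_smul]
  rfl

/-- `𝒯` of a finite sum. [folklore] -/
theorem trU_sum {ι' : Type*} (s : Finset ι') (f : ι' → 𝔘) :
    trU (∑ i ∈ s, f i) = ∑ i ∈ s, trU (f i) := by
  rw [trU, map_sum, Finset.unop_sum]
  rfl

end Transpose

section Centre

variable {T : Type*} [Fintype T] [DecidableEq T] {n : ℕ}

local notation "𝔘" => UniversalEnvelopingAlgebra ℂ (𝔤 T n)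

-- the PBW order `𝔫⁻ < 𝔥 < 𝔫⁺` on the indices of the standard basis (as in `HarishChandraCore`)
attribute [local instance] idxLinearOrder

/-- Transposing the standard basis: `(E^τ_{ab})ᵀ = E^τ_{ba}`. [folklore] -/
theorem btranspose_stdB (τ : T) (a b : Fin n) :
    btranspose (stdB T n (τ, a, b)) = stdB T n (τ, b, a) := by
  funext τ'
  ext c d
  simp only [btranspose_apply, stdB_apply_apply, Prod.mk.injEq]
  by_cases h : τ = τ' ∧ a = d ∧ b = c
  · rw [if_pos h, if_pos ⟨h.1, h.2.2, h.2.1⟩]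
  · rw [if_neg h, if_neg fun h' ↦ h ⟨h'.1, h'.2.2, h'.2.1⟩]

/-- `𝒯 (ι E^τ_{ab}) = ι E^τ_{ba}`. [folklore] -/
theorem trU_ι_stdB (τ : T) (a b : Fin n) :
    trU (UniversalEnvelopingAlgebra.ι ℂ (stdB T n (τ, a, b))) =
      UniversalEnvelopingAlgebra.ι ℂ (stdB T n (τ, b, a)) := by
  rw [trU_ι, btranspose_stdB]

/-- `𝒯 ((𝔼_τ^k)_{ab}) = (𝔼_τ^k)_{ba}`: transposing reverses the words `E_{a c₁} E_{c₁ c₂} ⋯ E_{c b}`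
and transposes each letter. [folklore] -/
theorem trU_genMatU_pow_apply (τ : T) (k : ℕ) (a b : Fin n) :
    trU ((genMatU n τ ^ k) a b) = (genMatU n τ ^ k) b a := by
  induction k generalizing a b with
  | zero =>
    rw [pow_zero]
    by_cases h : a = b
    · subst h
      rw [Matrix.one_apply_eq, trU_one]
    · rw [Matrix.one_apply_ne h, Matrix.one_apply_ne (Ne.symm h), trU_zero]
  | succ k ih =>
    conv_lhs => rw [pow_succ, Matrix.mul_apply, trU_sum]
    conv_rhs => rw [pow_succ', Matrix.mul_apply]
    refine Finset.sum_congr rfl fun c _ ↦ ?_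
    rw [trU_mul, ih, genMatU_apply, trU_ι_stdB, genMatU_apply]

/-- **The transpose anti-automorphism fixes the Casimir (Gelfand) elements**
`C_{τ,k} = tr(𝔼_τ^k) = ∑ E_{a₁a₂} E_{a₂a₃} ⋯ E_{a_k a₁}` (the reversed, transposed cycle is again
a cycle). [folklore] -/
theorem trU_casimir (τ : T) (k : ℕ) : trU (casimir n τ k) = casimir n τ k := by
  simp only [casimir, Matrix.trace, Matrix.diag_apply, trU_sum, trU_genMatU_pow_apply]

omit [DecidableEq T] in
/-- `𝒯` maps the centre into the centre. [folklore] -/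
theorem trU_mem_center {z : 𝔘} (hz : z ∈ Subalgebra.center ℂ 𝔘) :
    trU z ∈ Subalgebra.center ℂ 𝔘 := by
  refine mem_center_of_forall_ι fun x ↦ ?_
  have h := Subalgebra.mem_center_iff.1 hz (UniversalEnvelopingAlgebra.ι ℂ (btranspose x))
  have h2 := congrArg trU h
  rw [trU_mul, trU_mul, trU_ι, btranspose_btranspose] at h2
  exact h2.symm

omit [DecidableEq T] in
/-- **`𝒯` restricted to the (commutative) centre is an algebra endomorphism** of `Z(U)`.
[folklore] -/
def trCenter : Subalgebra.center ℂ 𝔘 →ₐ[ℂ] Subalgebra.center ℂ 𝔘 where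
  toFun z := ⟨trU (z : 𝔘), trU_mem_center z.2⟩
  map_one' := Subtype.ext trU_one
  map_mul' z w := Subtype.ext (by
    change trU ((z : 𝔘) * (w : 𝔘)) = trU (z : 𝔘) * trU (w : 𝔘)
    rw [trU_mul]
    exact Subalgebra.mem_center_iff.1 (trU_mem_center z.2) (trU (w : 𝔘)))
  map_zero' := Subtype.ext trU_zero
  map_add' z w := Subtype.ext (trU_add _ _)
  commutes' c := Subtype.ext (trU_algebraMap c)

omit [DecidableEq T] in
/-- Unfolding `trCenter`. [folklore] -/
@[simp] theorem coe_trCenter (z : Subalgebra.center ℂ 𝔘) : (trCenter z : 𝔘) = trU (z : 𝔘) := rfl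

/-- **`𝒯` fixes every polynomial in the Casimir elements** (`zOfPoly`). [folklore] -/
theorem trCenter_zOfPoly (P : MvPolynomial (T × Fin n) ℂ) :
    trCenter (zOfPoly T n P) = zOfPoly T n P := by
  have h : trCenter.comp (zOfPoly T n) = zOfPoly T n := by
    refine MvPolynomial.algHom_ext fun p ↦ ?_
    rw [AlgHom.comp_apply, zOfPoly, MvPolynomial.aeval_X]
    exact Subtype.ext (trU_casimir _ _)
  exact DFunLike.congr_fun h P

/-! ### The centre is generated by the Casimir elements (from Harish-Chandra surjectivity) -/

open Literature.RingTheory.MvPolynomial.BlockSymmetric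

/-- The central lift `G(C_{τ,k+1})` of a weighted homogeneous `G` of weight `d` lies in `U_d` with
restricted top symbol `G(p_{k+1}(x_{τ,·}))` — the witness of `HCCore.exists_center_lift` made
explicit. [cite: Humphreys1972, §23.3] -/
theorem zOfPoly_mem_fil_and_restrictDiag_symb {G : MvPolynomial (T × Fin n) ℂ} {d : ℕ}
    (hG : IsWeightedHomogeneous (blockWeight T n) G d) :
    (zOfPoly T n G : 𝔘) ∈ fil (stdB T n) d ∧
      restrictDiag T n ℂ (symb (stdB T n) d (zOfPoly T n G : 𝔘)) = blockPsumAeval T n ℂ G := by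
  classical
  have hG' : (zOfPoly T n G : 𝔘) = ∑ m ∈ G.support, coeff m G • (zOfPoly T n (monomial m 1) : 𝔘) := by
    conv_lhs => rw [← G.support_sum_monomial_coeff, map_sum]
    rw [AddSubmonoidClass.coe_finsetSum]
    refine Finset.sum_congr rfl fun m _ ↦ ?_
    rw [show monomial m (coeff m G) = coeff m G • monomial m 1 by rw [smul_monomial, smul_eq_mul, mul_one],
      map_smul, Subalgebra.coe_smul]
  refine ⟨?_, ?_⟩
  · rw [hG']
    refine Submodule.sum_mem _ fun m hm ↦ Submodule.smul_mem _ _ ?_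
    rw [← hG (mem_support_iff.mp hm)]
    exact (zOfPoly_monomial m).1
  · rw [hG', map_sum, map_sum]
    conv_rhs => rw [← G.support_sum_monomial_coeff, map_sum]
    refine Finset.sum_congr rfl fun m hm ↦ ?_
    rw [map_smul, map_smul, ← hG (mem_support_iff.mp hm), (zOfPoly_monomial m).2,
      show monomial m (coeff m G) = coeff m G • monomial m 1 by rw [smul_monomial, smul_eq_mul, mul_one], map_smul]

/-- The `γ'`-image of `G(C_{τ,k+1})`: total degree `≤ d` and top component `G(p_{k+1})`
(`HCCore.exists_gamma_top` with the witness explicit). [cite: Humphreys1972, §23.3] -/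
theorem zOfPoly_gamma_top {c : T × Fin n → ℂ}
    {γ' : Subalgebra.center ℂ 𝔘 →ₐ[ℂ] MvPolynomial (T × Fin n) ℂ} (hγ : HasHWProperty c γ')
    {G : MvPolynomial (T × Fin n) ℂ} {d : ℕ} (hG : IsWeightedHomogeneous (blockWeight T n) G d) :
    (γ' (zOfPoly T n G)).totalDegree ≤ d ∧
      homogeneousComponent d (γ' (zOfPoly T n G)) = blockPsumAeval T n ℂ G := by
  obtain ⟨hzf, hzs⟩ := zOfPoly_mem_fil_and_restrictDiag_symb hG
  rw [eq_shiftPoly_hcProj hγ]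
  have h := totalDegree_shiftPoly_le_and_homogeneousComponent_eq c (totalDegree_hcProj_le hzf)
  refine ⟨h.1, ?_⟩
  rw [h.2]
  change homogeneousComponent d (hcProj T n (zOfPoly T n G : 𝔘)) = _
  rw [homogeneousComponent_hcProj, hzs]

/-- **Every block-symmetric polynomial is `γ'` of a polynomial in the Casimir elements**
(`HCCore.exists_eq_gamma_of_mem` with the witnesses in the range of `zOfPoly`).
[cite: KnappVogan1995, Thm. 4.95 (onto); Humphreys1972, §23.3] -/
theorem exists_zOfPoly_gamma_eq {c : T × Fin n → ℂ}
    {γ' : Subalgebra.center ℂ 𝔘 →ₐ[ℂ] MvPolynomial (T × Fin n) ℂ} (hγ : HasHWProperty c γ')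
    (hsym : ∀ z, γ' z ∈ blockSymmetricSubalgebra T n ℂ) (d : ℕ) :
    ∀ f ∈ blockSymmetricSubalgebra T n ℂ, f.totalDegree ≤ d →
      ∃ P : MvPolynomial (T × Fin n) ℂ, γ' (zOfPoly T n P) = f := by
  induction d with
  | zero =>
    intro f hf hd
    obtain ⟨G, hG, hGf⟩ := exists_isWeightedHomogeneous_blockPsumAeval_eq T n hf
      ((totalDegree_zero_iff_isHomogeneous _).mp (Nat.le_zero.mp hd))
    obtain ⟨hz1, hz2⟩ := zOfPoly_gamma_top hγ hG
    refine ⟨G, ?_⟩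
    rw [← homogeneousComponent_eq_self ((totalDegree_zero_iff_isHomogeneous _).mp (Nat.le_zero.mp hz1)),
      hz2, hGf]
  | succ d ih =>
    intro f hf hd
    have hfd := homogeneousComponent_mem_blockSymmetricSubalgebra hf (d + 1)
    obtain ⟨G, hG, hGf⟩ := exists_isWeightedHomogeneous_blockPsumAeval_eq T n hfd
      (homogeneousComponent_isHomogeneous (d + 1) f)
    obtain ⟨hz1, hz2⟩ := zOfPoly_gamma_top hγ hG
    have hg : f - γ' (zOfPoly T n G) ∈ blockSymmetricSubalgebra T n ℂ :=
      Subalgebra.sub_mem _ hf (hsym _)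
    have hgd : (f - γ' (zOfPoly T n G)).totalDegree ≤ d := by
      refine totalDegree_le_of_homogeneousComponent_eq_zero ?_ ?_
      · exact (totalDegree_sub _ _).trans (max_le hd hz1)
      · rw [map_sub, hz2, hGf, sub_self]
    obtain ⟨P, hP⟩ := ih _ hg hgd
    refine ⟨P + G, ?_⟩
    rw [map_add, map_add, hP, sub_add_cancel]

/-- **The centre of `U(𝔤𝔩ₙ(ℂ)^T)` is generated by the Casimir elements**: granted an injective
`γ'` with the highest weight property and block-symmetric values (Harish-Chandra's isomorphism,
available for `T = (𝕜 →ₐ[ℝ] ℂ)` by `HarishChandraGLIsomorphism`), every central element is a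
polynomial in the `C_{τ,k}`. (Humphreys 1972, §23.3; Knapp 2002, Thm. 5.44.) [cite: Humphreys1972, §23.3] -/
theorem exists_zOfPoly_eq {c : T × Fin n → ℂ}
    {γ' : Subalgebra.center ℂ 𝔘 →ₐ[ℂ] MvPolynomial (T × Fin n) ℂ} (hγ : HasHWProperty c γ')
    (hsym : ∀ z, γ' z ∈ blockSymmetricSubalgebra T n ℂ) (hinj : Function.Injective γ')
    (z : Subalgebra.center ℂ 𝔘) : ∃ P : MvPolynomial (T × Fin n) ℂ, zOfPoly T n P = z := by
  obtain ⟨P, hP⟩ := exists_zOfPoly_gamma_eq hγ hsym (γ' z).totalDegree (γ' z) (hsym z) le_rfl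
  exact ⟨P, hinj hP⟩

/-- **The transpose anti-automorphism fixes the centre pointwise** (granted Harish-Chandra's
isomorphism in the above form): `𝒯 z = z` for `z ∈ Z(U(𝔤𝔩ₙ(ℂ)^T))`. [folklore] -/
theorem trU_eq_self_of_mem_center {c : T × Fin n → ℂ}
    {γ' : Subalgebra.center ℂ 𝔘 →ₐ[ℂ] MvPolynomial (T × Fin n) ℂ} (hγ : HasHWProperty c γ')
    (hsym : ∀ z, γ' z ∈ blockSymmetricSubalgebra T n ℂ) (hinj : Function.Injective γ')
    {z : 𝔘} (hz : z ∈ Subalgebra.center ℂ 𝔘) : trU z = z := by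
  obtain ⟨P, hP⟩ := exists_zOfPoly_eq hγ hsym hinj ⟨z, hz⟩
  have h := congrArg (fun w : Subalgebra.center ℂ 𝔘 ↦ (w : 𝔘)) (trCenter_zOfPoly P)
  simp only [coe_trCenter, hP] at h
  exact h

end Centre

end HCCore

/-! ### The real form: transpose and antipode on `U(𝔤𝔩ₙ(𝕜))` (`𝕜 = ℝ, ℂ`, real enveloping algebra) -/

section Real

variable (𝕜 : Type*) [RCLike 𝕜] (n : ℕ)

local notation "Uℝ" => UniversalEnvelopingAlgebra ℝ (Matrix (Fin n) (Fin n) 𝕜)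
local notation "Uℂ" => UniversalEnvelopingAlgebra ℂ (HCCore.𝔤 (𝕜 →ₐ[ℝ] ℂ) n)

/-- Transpose followed by `ι`, into the opposite real enveloping algebra. [folklore] -/
def transposeOpLieR : Matrix (Fin n) (Fin n) 𝕜 →ₗ⁅ℝ⁆ (Uℝ)ᵐᵒᵖ where
  toFun X := op (UniversalEnvelopingAlgebra.ι ℝ Xᵀ)
  map_add' X Y := by rw [Matrix.transpose_add, map_add, op_add]
  map_smul' c X := by rw [Matrix.transpose_smul, map_smul, op_smul, RingHom.id_apply]
  map_lie' {X Y} := by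
    have h : (⁅X, Y⁆ : Matrix (Fin n) (Fin n) 𝕜)ᵀ = ⁅Yᵀ, Xᵀ⁆ := by
      simp only [LieRing.of_associative_ring_bracket, Matrix.transpose_sub, Matrix.transpose_mul]
    rw [h, LieHom.map_lie, LieRing.of_associative_ring_bracket, LieRing.of_associative_ring_bracket,
      op_sub, op_mul, op_mul]

/-- **The transpose anti-automorphism of the real enveloping algebra `U(𝔤𝔩ₙ(𝕜))`**, as an
algebra homomorphism `U → Uᵐᵒᵖ` extending `X ↦ Xᵀ`. [folklore] -/
def transposeHomR : Uℝ →ₐ[ℝ] (Uℝ)ᵐᵒᵖ :=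
  UniversalEnvelopingAlgebra.lift ℝ (transposeOpLieR 𝕜 n)

/-- `-ι`, into the opposite real enveloping algebra (`X ↦ -X` is a Lie anti-homomorphism).
[folklore] -/
def antipodeOpLie : Matrix (Fin n) (Fin n) 𝕜 →ₗ⁅ℝ⁆ (Uℝ)ᵐᵒᵖ where
  toFun X := op (-UniversalEnvelopingAlgebra.ι ℝ X)
  map_add' X Y := by rw [map_add, neg_add, op_add]
  map_smul' c X := by rw [map_smul, ← smul_neg, op_smul, RingHom.id_apply]
  map_lie' {X Y} := by
    rw [LieHom.map_lie, LieRing.of_associative_ring_bracket, LieRing.of_associative_ring_bracket,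
      neg_sub, op_sub, op_mul, op_mul, op_neg, op_neg, neg_mul_neg, neg_mul_neg]

/-- **The antipode (principal anti-automorphism) `S` of `U(𝔤𝔩ₙ(𝕜))`**: the algebra homomorphism
`U → Uᵐᵒᵖ` extending `X ↦ -X` (Dixmier, *Enveloping Algebras*, 2.2.18). It is the adjoint map
for invariant Hermitian forms: `⟨u v, w⟩ = ⟨v, S(u) w⟩` (Knapp–Vogan 1995, Ch. IX §1). [folklore] -/
def antipodeHom : Uℝ →ₐ[ℝ] (Uℝ)ᵐᵒᵖ :=
  UniversalEnvelopingAlgebra.lift ℝ (antipodeOpLie 𝕜 n)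

/-- The Lie algebra automorphism `θ₀ : X ↦ -Xᵀ` of `𝔤𝔩ₙ(𝕜)` (a Cartan-type involution).
[folklore] -/
def negTransposeLieEquiv : Matrix (Fin n) (Fin n) 𝕜 ≃ₗ⁅ℝ⁆ Matrix (Fin n) (Fin n) 𝕜 where
  toFun X := -Xᵀ
  invFun X := -Xᵀ
  map_add' X Y := by rw [Matrix.transpose_add, neg_add]
  map_smul' c X := by rw [Matrix.transpose_smul, smul_neg, RingHom.id_apply]
  map_lie' {X Y} := by
    simp only [LieRing.of_associative_ring_bracket, Matrix.transpose_sub, Matrix.transpose_mul,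
      Matrix.neg_mul, Matrix.mul_neg, neg_neg]
    abel
  left_inv X := by simp
  right_inv X := by simp

variable {𝕜 n}

/-- Unfolding `θ₀`. [folklore] -/
@[simp] theorem negTransposeLieEquiv_apply (X : Matrix (Fin n) (Fin n) 𝕜) :
    negTransposeLieEquiv 𝕜 n X = -Xᵀ := rfl

/-- `𝒯` on the real enveloping algebra, as a map `U → U`. [folklore] -/
def trR (u : Uℝ) : Uℝ := unop (transposeHomR 𝕜 n u)

/-- The antipode as a map `U → U`. [folklore] -/
def antiR (u : Uℝ) : Uℝ := unop (antipodeHom 𝕜 n u)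

/-- The automorphism `U(θ₀)` of `U(𝔤𝔩ₙ(𝕜))` induced by `θ₀ : X ↦ -Xᵀ`. [folklore] -/
def negTransposeU : Uℝ →ₐ[ℝ] Uℝ :=
  UniversalEnvelopingAlgebra.lift ℝ ((UniversalEnvelopingAlgebra.ι ℝ).comp (negTransposeLieEquiv 𝕜 n).toLieHom)

/-- `𝒯 (ι X) = ι (Xᵀ)` (real form). [folklore] -/
theorem trR_ι (X : Matrix (Fin n) (Fin n) 𝕜) :
    trR (UniversalEnvelopingAlgebra.ι ℝ X) = UniversalEnvelopingAlgebra.ι ℝ Xᵀ := by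
  rw [trR, transposeHomR, UniversalEnvelopingAlgebra.lift_ι_apply]
  rfl

/-- `𝒯` is anti-multiplicative (real form). [folklore] -/
theorem trR_mul (u v : Uℝ) : trR (u * v) = trR v * trR u := by
  rw [trR, map_mul, unop_mul]
  rfl

/-- `𝒯` is additive (real form). [folklore] -/
theorem trR_add (u v : Uℝ) : trR (u + v) = trR u + trR v := by
  rw [trR, map_add, unop_add]
  rfl

/-- `𝒯` fixes the scalars (real form). [folklore] -/
theorem trR_algebraMap (r : ℝ) : trR (algebraMap ℝ Uℝ r) = algebraMap ℝ Uℝ r := by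
  rw [trR, AlgHom.commutes, MulOpposite.algebraMap_apply, unop_op]

/-- `S (ι X) = -ι X`. [folklore] -/
theorem antiR_ι (X : Matrix (Fin n) (Fin n) 𝕜) :
    antiR (UniversalEnvelopingAlgebra.ι ℝ X) = -UniversalEnvelopingAlgebra.ι ℝ X := by
  rw [antiR, antipodeHom, UniversalEnvelopingAlgebra.lift_ι_apply]
  rfl

/-- `S` is anti-multiplicative. [folklore] -/
theorem antiR_mul (u v : Uℝ) : antiR (u * v) = antiR v * antiR u := by
  rw [antiR, map_mul, unop_mul]
  rfl

/-- `S` is additive. [folklore] -/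
theorem antiR_add (u v : Uℝ) : antiR (u + v) = antiR u + antiR v := by
  rw [antiR, map_add, unop_add]
  rfl

/-- `S` is real-linear. [folklore] -/
theorem antiR_smul (r : ℝ) (u : Uℝ) : antiR (r • u) = r • antiR u := by
  rw [antiR, map_smul, unop_smul]
  rfl

/-- `S` fixes the scalars. [folklore] -/
theorem antiR_algebraMap (r : ℝ) : antiR (algebraMap ℝ Uℝ r) = algebraMap ℝ Uℝ r := by
  rw [antiR, AlgHom.commutes, MulOpposite.algebraMap_apply, unop_op]

/-- `U(θ₀) (ι X) = -ι (Xᵀ)`. [folklore] -/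
theorem negTransposeU_ι (X : Matrix (Fin n) (Fin n) 𝕜) :
    negTransposeU (UniversalEnvelopingAlgebra.ι ℝ X) = -UniversalEnvelopingAlgebra.ι ℝ Xᵀ := by
  rw [negTransposeU, UniversalEnvelopingAlgebra.lift_ι_apply, LieHom.comp_apply, LieEquiv.coe_toLieHom,
    negTransposeLieEquiv_apply, map_neg]

/-- **`S = U(θ₀) ∘ 𝒯`**: the antipode is the transpose anti-automorphism followed by the
automorphism induced by `θ₀ : X ↦ -Xᵀ` (both sides are anti-homomorphisms agreeing on `𝔤`).
[folklore] -/
theorem antiR_eq_negTransposeU_trR (u : Uℝ) : antiR u = negTransposeU (trR u) := by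
  induction u using UniversalEnvelopingAlgebra.induction_on' with
  | algebraMap r => rw [antiR_algebraMap, trR_algebraMap, AlgHom.commutes]
  | ι X => rw [antiR_ι, trR_ι, negTransposeU_ι, Matrix.transpose_transpose]
  | mul a b ha hb => rw [antiR_mul, trR_mul, map_mul, ha, hb]
  | add a b ha hb => rw [antiR_add, trR_add, map_add, ha, hb]

/-- **The complexification intertwines the transposes**: `Φ(𝒯 u) = 𝒯_ℂ(Φ u)` for the real algebra
map `Φ : U(𝔤𝔩ₙ(𝕜)) → U(∏_τ 𝔤𝔩ₙ(ℂ))` (`envHom`), since `(τ(X))ᵀ = τ(Xᵀ)`. [folklore] -/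
theorem envHom_trR (u : Uℝ) : envHom 𝕜 n (trR u) = HCCore.trU (envHom 𝕜 n u) := by
  induction u using UniversalEnvelopingAlgebra.induction_on' with
  | algebraMap r =>
    rw [trR_algebraMap, AlgHom.commutes, IsScalarTower.algebraMap_apply ℝ ℂ Uℂ, HCCore.trU_algebraMap]
  | ι X =>
    rw [trR_ι, envHom_ι, envHom_ι, HCCore.trU_ι]
    congr 1
  | mul a b ha hb => rw [trR_mul, map_mul, map_mul, ha, hb, HCCore.trU_mul]
  | add a b ha hb => rw [trR_add, map_add, map_add, ha, hb, HCCore.trU_add]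

/-- `Φ` is injective (`ℂ ⊗ Φ` is bijective and `u ↦ 1 ⊗ u` is injective, `reT`). [folklore] -/
theorem envHom_injective : Function.Injective (envHom 𝕜 n) := by
  intro u v h
  have h1 : envHomC 𝕜 n ((1 : ℂ) ⊗ₜ u) = envHomC 𝕜 n ((1 : ℂ) ⊗ₜ v) := by
    rw [envHomC_tmul, envHomC_tmul, h]
  have h2 := envHomC_injective h1
  have h3 := congrArg (reT Uℝ) h2
  rwa [reT_tmul, reT_tmul, Complex.one_re, one_smul, one_smul] at h3

/-- `Φ` maps the centre into the centre (`centerHomC_mem_center`). [folklore] -/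
theorem envHom_mem_center {z : Uℝ} (hz : z ∈ Subalgebra.center ℝ Uℝ) :
    envHom 𝕜 n z ∈ Subalgebra.center ℂ Uℂ := by
  have h := centerHomC_mem_center (𝕜 := 𝕜) (n := n) ((1 : ℂ) ⊗ₜ ⟨z, hz⟩)
  rwa [centerHomC_tmul, one_smul] at h

/-- **The transpose anti-automorphism of `U(𝔤𝔩ₙ(𝕜))` fixes the centre pointwise**: transport
of `HCCore.trU_eq_self_of_mem_center` (Harish-Chandra: the centre of `U(𝔤_ℂ)` is generated by the
Casimir elements, which are transpose-invariant) along the injective `Φ`. [folklore] -/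
theorem trR_eq_self_of_mem_center {z : Uℝ} (hz : z ∈ Subalgebra.center ℝ Uℝ) : trR z = z := by
  classical
  apply envHom_injective
  rw [envHom_trR]
  exact HCCore.trU_eq_self_of_mem_center (harishChandraHomGL 𝕜 n).hasHWProperty_complexified
    (harishChandraHomGL 𝕜 n).complexified_mem (harishChandraHomGL 𝕜 n).complexified_injective_and_range_eq.1
    (envHom_mem_center hz)

/-- **On the centre the antipode is the automorphism `U(θ₀)`**: `S z = U(θ₀) z` for central `z`.
[folklore] -/
theorem antiR_eq_negTransposeU_of_mem_center {z : Uℝ} (hz : z ∈ Subalgebra.center ℝ Uℝ) :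
    antiR z = negTransposeU z := by
  rw [antiR_eq_negTransposeU_trR, trR_eq_self_of_mem_center hz]

/-- `U(θ₀)` maps the centre into the centre. [folklore] -/
theorem negTransposeU_mem_center {z : Uℝ} (hz : z ∈ Subalgebra.center ℝ Uℝ) :
    negTransposeU z ∈ Subalgebra.center ℝ Uℝ :=
  lift_ι_comp_mem_center (negTransposeLieEquiv 𝕜 n) hz

/-- The antipode maps the centre into the centre. [folklore] -/
theorem antiR_mem_center {z : Uℝ} (hz : z ∈ Subalgebra.center ℝ Uℝ) :
    antiR z ∈ Subalgebra.center ℝ Uℝ := by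
  rw [antiR_eq_negTransposeU_of_mem_center hz]
  exact negTransposeU_mem_center hz

end Real

/-! ### The Weyl twist: `γ(U(θ₀) z)(x) = γ(z)(-x)` and `γ(S z)(x) = γ(z)(-x)` -/

section WeylTwist

variable (𝕜 : Type*) [RCLike 𝕜] (n : ℕ)

local notation "Uℝ" => UniversalEnvelopingAlgebra ℝ (Matrix (Fin n) (Fin n) 𝕜)

/-- The order-reversing permutation matrix `w₀` (`(w₀)_{ij} = δ_{j, rev i}`), a representative of
the longest element of the Weyl group `𝔖ₙ`. [folklore] -/
def revMat : Matrix (Fin n) (Fin n) 𝕜 := Matrix.of fun i j ↦ if j = Fin.rev i then 1 else 0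

variable {𝕜 n}

/-- `(w₀ X)_{ij} = X_{rev i, j}`. [folklore] -/
theorem revMat_mul_apply (X : Matrix (Fin n) (Fin n) 𝕜) (i j : Fin n) :
    (revMat 𝕜 n * X) i j = X (Fin.rev i) j := by
  rw [Matrix.mul_apply, Finset.sum_eq_single (Fin.rev i)]
  · rw [revMat, Matrix.of_apply, if_pos rfl, one_mul]
  · intro k _ hk
    rw [revMat, Matrix.of_apply, if_neg hk, zero_mul]
  · intro h
    exact absurd (Finset.mem_univ _) h

/-- `(X w₀)_{ij} = X_{i, rev j}`. [folklore] -/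
theorem mul_revMat_apply (X : Matrix (Fin n) (Fin n) 𝕜) (i j : Fin n) :
    (X * revMat 𝕜 n) i j = X i (Fin.rev j) := by
  rw [Matrix.mul_apply, Finset.sum_eq_single (Fin.rev j)]
  · rw [revMat, Matrix.of_apply, if_pos (Fin.rev_rev j).symm, mul_one]
  · intro k _ hk
    rw [revMat, Matrix.of_apply, if_neg, mul_zero]
    intro h
    apply hk
    rw [h, Fin.rev_rev]
  · intro h
    exact absurd (Finset.mem_univ _) h

/-- `w₀² = 1`. [folklore] -/
theorem revMat_mul_revMat : revMat 𝕜 n * revMat 𝕜 n = 1 := by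
  ext i j
  rw [revMat_mul_apply, revMat, Matrix.of_apply, Fin.rev_rev, Matrix.one_apply]
  by_cases h : i = j
  · rw [if_pos h.symm, if_pos h]
  · rw [if_neg (Ne.symm h), if_neg h]

/-- `(w₀ X w₀)_{ij} = X_{rev i, rev j}`. [folklore] -/
theorem revMat_conj_apply (X : Matrix (Fin n) (Fin n) 𝕜) (i j : Fin n) :
    (revMat 𝕜 n * X * revMat 𝕜 n) i j = X (Fin.rev i) (Fin.rev j) := by
  rw [mul_revMat_apply, revMat_mul_apply]

/-- `w₀` is invertible. [folklore] -/
theorem isUnit_det_revMat : IsUnit (revMat 𝕜 n).det :=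
  Matrix.isUnit_det_of_right_inverse revMat_mul_revMat

/-- `w₀⁻¹ = w₀`. [folklore] -/
theorem revMat_inv : (revMat 𝕜 n)⁻¹ = revMat 𝕜 n :=
  Matrix.inv_eq_right_inv revMat_mul_revMat

/-- `Ad(w₀) ∘ θ₀` preserves `𝔫`: for `X` strictly upper triangular, `w₀ (-Xᵀ) w₀` is strictly upper
triangular. [folklore] -/
theorem revMat_conj_neg_transpose_mem_upperNilpLie {X : Matrix (Fin n) (Fin n) 𝕜}
    (hX : X ∈ upperNilpLie 𝕜 n) : revMat 𝕜 n * (-Xᵀ) * revMat 𝕜 n ∈ upperNilpLie 𝕜 n := by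
  rw [mem_upperNilpLie_iff] at hX ⊢
  intro i j hji
  rw [revMat_conj_apply, Matrix.neg_apply, Matrix.transpose_apply, hX _ _ (Fin.rev_le_rev.2 hji),
    neg_zero]

/-- `Ad(w₀) ∘ θ₀` on the diagonal: `w₀ (-diag(h)ᵀ) w₀ = diag(-h ∘ rev)`. [folklore] -/
theorem revMat_conj_neg_transpose_diagonal (h : Fin n → 𝕜) :
    revMat 𝕜 n * (-(Matrix.diagonal h)ᵀ) * revMat 𝕜 n = Matrix.diagonal fun i ↦ -h (Fin.rev i) := by
  ext i j
  rw [revMat_conj_apply, Matrix.diagonal_transpose, Matrix.neg_apply, Matrix.diagonal_apply,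
    Matrix.diagonal_apply]
  by_cases hij : i = j
  · subst hij
    rw [if_pos rfl, if_pos rfl]
  · rw [if_neg (fun h ↦ hij (Fin.rev_injective h)), if_neg hij, neg_zero]

/-- The weight `λ ↦ -λ ∘ rev` (the action of `Ad(w₀) ∘ θ₀` on weights: `λ' τ i = -λ τ (rev i)`).
[folklore] -/
def revWeight (l : ArchWeightGL 𝕜 n) : ArchWeightGL 𝕜 n := fun τ i ↦ -l τ (Fin.rev i)

/-- The weight of `diag(-h ∘ rev)` for `λ` is the weight of `diag(h)` for `λ' = -λ ∘ rev`.
[folklore] -/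
theorem weightFun_neg_rev (l : ArchWeightGL 𝕜 n) (h : Fin n → 𝕜) :
    weightFun l (fun i ↦ -h (Fin.rev i)) = weightFun (revWeight l) h := by
  simp only [weightFun, revWeight, map_neg, mul_neg, neg_mul]
  refine Finset.sum_congr rfl fun τ _ ↦ ?_
  rw [← Equiv.sum_comp Fin.revPerm (fun i ↦ -(l τ (Fin.rev i) * τ (h i)))]
  simp only [Fin.revPerm_apply, Fin.rev_rev]

/-- **The Weyl twist of a highest weight vector.** If `v` is a highest weight vector of weight
`λ` for `ρ`, then it is a highest weight vector of weight `-λ ∘ rev` for the twisted representation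
`ρ ∘ Ad(w₀) ∘ θ₀` (`θ₀ X = -Xᵀ`): the automorphism `Ad(w₀) ∘ θ₀` of `𝔤𝔩ₙ(𝕜)` preserves `𝔫` and
acts on `𝔥` by `h ↦ -w₀(h)`. [folklore] -/
theorem IsHighestWeightVector.weylTwist {V : Type*} [AddCommGroup V] [Module ℂ V]
    {ρ : Matrix (Fin n) (Fin n) 𝕜 →ₗ⁅ℝ⁆ Module.End ℂ V} {l : ArchWeightGL 𝕜 n} {v : V}
    (hv : IsHighestWeightVector ρ l v)
    (e : Matrix (Fin n) (Fin n) 𝕜 →ₗ⁅ℝ⁆ Matrix (Fin n) (Fin n) 𝕜)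
    (he : ∀ X, e X = revMat 𝕜 n * X * (revMat 𝕜 n)⁻¹) :
    IsHighestWeightVector ((ρ.comp e).comp (negTransposeLieEquiv 𝕜 n).toLieHom) (revWeight l) v := by
  refine ⟨hv.1, fun X hX ↦ ?_, fun h ↦ ?_⟩
  · change ρ (e (-Xᵀ)) v = 0
    rw [he, revMat_inv]
    exact hv.2.1 _ (revMat_conj_neg_transpose_mem_upperNilpLie hX)
  · change ρ (e (-(Matrix.diagonal h)ᵀ)) v = _
    rw [he, revMat_inv, revMat_conj_neg_transpose_diagonal, hv.2.2, weightFun_neg_rev]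

/-- **`γ(U(θ₀) z)(x) = γ(z)(-x)`** for every Harish-Chandra homomorphism `γ`, central `z` and
`θ₀ X = -Xᵀ`. On the highest weight vector `v_λ` of the model module, `U(θ₀) z` acts by
`γ(U(θ₀) z)(λ + ρ)`; on the other hand `U(θ₀) z = U(Ad w₀)(U(θ₀) z) = U(Ad w₀ ∘ θ₀) z` (the adjoint
group fixes the centre, `lift_comp_conj_eq_lift`) acts as `z` does in the Weyl-twisted module, where
`v_λ` has weight `-λ ∘ rev`, i.e. by `γ(z)(-λ ∘ rev + ρ) = γ(z)((-(λ + ρ)) ∘ rev) = γ(z)(-(λ + ρ))`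
(`ρ_{rev i} = -ρ_i`, `𝔖ₙ`-symmetry of `γ(z)`). Knapp 2002, Thm. 5.44 (with the `W`-invariance of
`γ`); this is the infinitesimal-character form of "the contragredient of the module of parameter
`λ` has parameter `-λ`". [cite: Knapp2002, §V.5 Thm. 5.44] -/
theorem HarishChandraHomGL.aeval_negTransposeU (γ : HarishChandraHomGL 𝕜 n) {z : Uℝ}
    (hz : z ∈ Subalgebra.center ℝ Uℝ) (x : (𝕜 →ₐ[ℝ] ℂ) × Fin n → ℂ) :
    MvPolynomial.aeval x (γ.toAlgHom ⟨negTransposeU z, negTransposeU_mem_center hz⟩) =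
      MvPolynomial.aeval (fun p ↦ -x p) (γ.toAlgHom ⟨z, hz⟩) := by
  classical
  -- the weight `l` with `x = l + ρ`
  set l : ArchWeightGL 𝕜 n := fun τ j ↦ x (τ, j) - rhoGL n j with hl
  have hx : x = fun p : (𝕜 →ₐ[ℝ] ℂ) × Fin n ↦ l p.1 p.2 + rhoGL n p.2 := by
    funext p
    simp [hl]
  have hv := HCModel.isHighestWeightVector_hwVec (𝕜 := 𝕜) l
  obtain ⟨e, he, -⟩ := exists_lieHom_conj (revMat 𝕜 n) isUnit_det_revMat
  have hv' := hv.weylTwist e he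
  -- `z` acts in the Weyl-twisted model by `γ(z)(-l ∘ rev + ρ)`, and through `U(θ₀) z` in the model
  have k₁ := γ.highestWeight _ (((HCModel.modelRep 𝕜 n).rho.comp e).comp
    (negTransposeLieEquiv 𝕜 n).toLieHom) (revWeight l) (HCModel.hwVec l) hv' ⟨z, hz⟩
  rw [UniversalEnvelopingAlgebra.lift_comp_apply] at k₁
  change UniversalEnvelopingAlgebra.lift ℝ ((HCModel.modelRep 𝕜 n).rho.comp e) (negTransposeU z)
    (HCModel.hwVec l) = _ at k₁
  rw [lift_comp_conj_eq_lift _ isUnit_det_revMat e he (negTransposeU_mem_center hz)] at k₁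
  -- `U(θ₀) z` acts in the model by `γ(U(θ₀) z)(l + ρ)`
  have k₂ := γ.highestWeight _ (HCModel.modelRep 𝕜 n).rho l (HCModel.hwVec l) hv
    ⟨negTransposeU z, negTransposeU_mem_center hz⟩
  have k₃ := smul_hwVec_injective 𝕜 n l (k₂.symm.trans k₁)
  rw [hx, k₃]
  -- `-l ∘ rev + ρ = (-(l + ρ)) ∘ rev`, and `γ(z)` is `𝔖ₙ`-symmetric
  have hpt : (fun p : (𝕜 →ₐ[ℝ] ℂ) × Fin n ↦ revWeight l p.1 p.2 + rhoGL n p.2) =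
      (fun p : (𝕜 →ₐ[ℝ] ℂ) × Fin n ↦ -(l p.1 p.2 + rhoGL n p.2)) ∘
        (Equiv.prodCongrRight fun _ : (𝕜 →ₐ[ℝ] ℂ) ↦ Fin.revPerm) := by
    funext ⟨τ, j⟩
    simp only [revWeight, Function.comp_apply, Equiv.prodCongrRight_apply, Fin.revPerm_apply,
      rhoGL_rev]
    ring
  rw [hpt, ← MvPolynomial.aeval_rename, γ.symmetric]

/-- **`γ(S z)(x) = γ(z)(-x)`: the antipode acts on the Harish-Chandra parameter by `x ↦ -x`.**
For `z ∈ Z(𝔤𝔩ₙ(𝕜))` the antipode `S z` is again central and `γ(S z) = γ(z)(-x)`: `S = U(θ₀) ∘ 𝒯`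
with `𝒯` the transpose anti-automorphism, `𝒯` fixes the centre (Harish-Chandra: `Z(𝔤_ℂ)` is
generated by the transpose-invariant Casimir elements), and `γ(U(θ₀) z)(x) = γ(z)(-x)`
(`HarishChandraHomGL.aeval_negTransposeU`). This is the infinitesimal-character form of
"the contragredient has parameter `-λ`" (Knapp 2002, Thm. 5.44; Knapp–Vogan 1995, Ch. IX §1, the
adjoint `u ↦ S(u)` for invariant Hermitian forms). [cite: Knapp2002, §V.5 Thm. 5.44] -/
theorem HarishChandraHomGL.aeval_antiR (γ : HarishChandraHomGL 𝕜 n) {z : Uℝ}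
    (hz : z ∈ Subalgebra.center ℝ Uℝ) (x : (𝕜 →ₐ[ℝ] ℂ) × Fin n → ℂ) :
    MvPolynomial.aeval x (γ.toAlgHom ⟨antiR z, antiR_mem_center hz⟩) =
      MvPolynomial.aeval (fun p ↦ -x p) (γ.toAlgHom ⟨z, hz⟩) := by
  have h : (⟨antiR z, antiR_mem_center hz⟩ : Subalgebra.center ℝ Uℝ) =
      ⟨negTransposeU z, negTransposeU_mem_center hz⟩ :=
    Subtype.ext (antiR_eq_negTransposeU_of_mem_center hz)
  rw [h]
  exact γ.aeval_negTransposeU hz x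

end WeylTwist

end Literature.NumberTheory.Automorphic

end
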